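import Mathlib.Combinatorics.SetFamily.Compression.Down
import Mathlib.Tactic
import HarnessLib
import HarnessLib.Audit.Tags
import Summits.CriticalPhenomena.PercolationContinuityZ3.Theorems.PercNearOneGluingNoHeavyLowerTailSahiPartitionDaykin

/-!
# The rainbow lemma: the credit lemma for compression at a point

Support file (seat `prim-masterthm-p1`, gen 33; `--supports stmt-CriticalPhenomena-4575`).  Pure theorems over `…SahiPartitionDaykin`; no `sorry`, standard axioms.
Memo `run/shared/lean/prim/prim-masterthm/FROM-prim-masterthm-p1-g33-PARTITION-AND-RAINBOW.md` §7.

For a family `𝒜 ⊆ 2^F` and a point `r ∈ F` put `𝔅 = 𝒜.memberSubfamily r ∪ 𝒜.nonMemberSubfamily r` (projections `a.erase r`) and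
`𝔄 = 𝒜.memberSubfamily r ∩ 𝒜.nonMemberSubfamily r` (the `r`-free `x` with `x, insert r x ∈ 𝒜`), so that `#𝔄 + #𝔅 = #𝒜`.  **`card_rainbowMeets_compress`:
`#rainbowMeets (F.erase r) 𝔅 + #{x ∩ y, (F.erase r) \ (x ∪ y) : x ≠ y ∈ 𝔄} ≤ #rainbowMeets F 𝒜`** — every rainbow meet of `𝔅` has a lift (itself or with `r` inserted)
among the rainbow meets of `𝒜`, and the meets / complemented joins of two DISTINCT doubled members have both lifts.  This is the exact analogue of
`card_meetsJoins_compress` (which proves the meets-and-joins theorem `card_le_card_meetsJoins`); the difference — a single doubled member contributes only the two LOWER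
lifts `x` and `(F.erase r) \ x` — is why the same induction proves `RainbowMeetCojoin` only up to the GOOD-point condition of the memo (§7), and is recorded here as the
reusable half of that argument.  HONEST FRAMING: a lemma; `RainbowMeetCojoin` remains OPEN. [this work]
-/

namespace Summit.CriticalPhenomena.PercolationContinuityZ3.Theorems.SahiColouredDaykin

open Finset

variable {α : Type*} [DecidableEq α]

/-- Unpacking membership in `rainbowMeets`. [this work] -/
theorem mem_rainbowMeets_iff {F : Finset α} {𝒜 : Finset (Finset α)} {Z : Finset α} :
    Z ∈ rainbowMeets F 𝒜 ↔ Z = ∅ ∨ ∃ a ∈ 𝒜, ∃ b ∈ 𝒜, a ≠ b ∧ (Z = a ∩ b ∨ Z = F \ (a ∪ b)) := by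
  unfold rainbowMeets
  simp only [mem_insert, mem_union, mem_image, mem_offDiag, Prod.exists]
  constructor
  · rintro (rfl | ⟨a, b, ⟨ha, hb, hab⟩, rfl⟩ | ⟨a, b, ⟨ha, hb, hab⟩, rfl⟩)
    · exact Or.inl rfl
    · exact Or.inr ⟨a, ha, b, hb, hab, Or.inl rfl⟩
    · exact Or.inr ⟨a, ha, b, hb, hab, Or.inr rfl⟩
  · rintro (rfl | ⟨a, ha, b, hb, hab, rfl | rfl⟩)
    · exact Or.inl rfl
    · exact Or.inr (Or.inl ⟨a, b, ⟨ha, hb, hab⟩, rfl⟩)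
    · exact Or.inr (Or.inr ⟨a, b, ⟨ha, hb, hab⟩, rfl⟩)

/-- Meets of distinct members are rainbow meets. [this work] -/
theorem inter_mem_rainbowMeets {F : Finset α} {𝒜 : Finset (Finset α)} {a b : Finset α} (ha : a ∈ 𝒜) (hb : b ∈ 𝒜) (hab : a ≠ b) :
    a ∩ b ∈ rainbowMeets F 𝒜 :=
  mem_rainbowMeets_iff.2 (Or.inr ⟨a, ha, b, hb, hab, Or.inl rfl⟩)

/-- Complemented joins of distinct members are rainbow meets. [this work] -/
theorem sdiff_union_mem_rainbowMeets {F : Finset α} {𝒜 : Finset (Finset α)} {a b : Finset α} (ha : a ∈ 𝒜) (hb : b ∈ 𝒜) (hab : a ≠ b) :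
    F \ (a ∪ b) ∈ rainbowMeets F 𝒜 :=
  mem_rainbowMeets_iff.2 (Or.inr ⟨a, ha, b, hb, hab, Or.inr rfl⟩)

/-- **CREDIT LEMMA for the rainbow lemma (compression at `r ∈ F`).**  With `𝔅 = 𝒜.memberSubfamily r ∪ 𝒜.nonMemberSubfamily r` (projections) and
`𝔄 = 𝒜.memberSubfamily r ∩ 𝒜.nonMemberSubfamily r` (doubled members), both families of subsets of `F.erase r`:
`#rainbowMeets (F.erase r) 𝔅 + #{meets and complemented joins of DISTINCT members of 𝔄} ≤ #rainbowMeets F 𝒜` — every rainbow meet of `𝔅` has a lift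
(itself or with `r` inserted) among the rainbow meets of `𝒜`, and every meet / complemented join of two distinct doubled members has BOTH lifts.  (A single doubled
member `x` contributes only the two LOWER lifts `x = x ∩ (x+r)` and `(F.erase r) \\ x = F \\ (x ∪ (x+r))`; this is why the induction for `RainbowMeetCojoin` is short by
one exactly when `𝔄 ≠ ∅` has no disjoint / covering pair and `{r}` is not a rainbow meet — memo §7.) [this work] -/
theorem card_rainbowMeets_compress (F : Finset α) (𝒜 : Finset (Finset α)) (r : α) (hr : r ∈ F) :
    #(rainbowMeets (F.erase r) (𝒜.memberSubfamily r ∪ 𝒜.nonMemberSubfamily r)) +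
      #(((𝒜.memberSubfamily r ∩ 𝒜.nonMemberSubfamily r).offDiag.image fun p => p.1 ∩ p.2) ∪
        ((𝒜.memberSubfamily r ∩ 𝒜.nonMemberSubfamily r).offDiag.image fun p => (F.erase r) \ (p.1 ∪ p.2)))
      ≤ #(rainbowMeets F 𝒜) := by
  set M := 𝒜.memberSubfamily r with hM
  set N := 𝒜.nonMemberSubfamily r with hN
  set L := rainbowMeets F 𝒜 with hL
  -- lifting members of the projected family
  have lift : ∀ {z}, z ∈ M ∪ N → r ∉ z ∧ ∃ a ∈ 𝒜, a.erase r = z := by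
    intro z hz
    rcases mem_union.1 hz with hz | hz
    · obtain ⟨hz1, hz2⟩ := mem_memberSubfamily.1 hz
      exact ⟨hz2, insert r z, hz1, erase_insert hz2⟩
    · obtain ⟨hz1, hz2⟩ := mem_nonMemberSubfamily.1 hz
      exact ⟨hz2, z, hz1, erase_eq_of_notMem hz2⟩
  -- (1) every rainbow meet of the projections has a lift
  have h1 : rainbowMeets (F.erase r) (M ∪ N) ⊆ L.memberSubfamily r ∪ L.nonMemberSubfamily r := by
    intro W hW
    rcases mem_rainbowMeets_iff.1 hW with rfl | ⟨x, hx, y, hy, hxy, hW⟩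
    · exact mem_union.2 (Or.inr (mem_nonMemberSubfamily.2 ⟨mem_rainbowMeets_iff.2 (Or.inl rfl), notMem_empty r⟩))
    obtain ⟨hrx, a, ha, hax⟩ := lift hx
    obtain ⟨hry, b, hb, hby⟩ := lift hy
    have hab : a ≠ b := by rintro rfl; exact hxy (hax.symm.trans hby)
    have key : ∃ Z ∈ L, Z.erase r = W ∧ r ∉ W := by
      rcases hW with rfl | rfl
      · refine ⟨a ∩ b, inter_mem_rainbowMeets ha hb hab, ?_, fun h => hrx (mem_inter.1 h).1⟩
        rw [← hax, ← hby]; ext t; simp only [mem_erase, mem_inter]; tauto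
      · refine ⟨F \ (a ∪ b), sdiff_union_mem_rainbowMeets ha hb hab, ?_, fun h => (notMem_erase r F) (mem_sdiff.1 h).1⟩
        rw [← hax, ← hby]; ext t; simp only [mem_erase, mem_sdiff, mem_union]; tauto
    obtain ⟨Z, hZ, hZW, hrW⟩ := key
    by_cases hrZ : r ∈ Z
    · refine mem_union.2 (Or.inl (mem_memberSubfamily.2 ⟨?_, hrW⟩))
      rwa [← hZW, insert_erase hrZ]
    · refine mem_union.2 (Or.inr (mem_nonMemberSubfamily.2 ⟨?_, hrW⟩))
      rwa [← hZW, erase_eq_of_notMem hrZ]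
  -- (2) meets / complemented joins of two distinct doubled members have both lifts
  have h2 : ((M ∩ N).offDiag.image fun p => p.1 ∩ p.2) ∪ ((M ∩ N).offDiag.image fun p => (F.erase r) \ (p.1 ∪ p.2)) ⊆
      L.memberSubfamily r ∩ L.nonMemberSubfamily r := by
    intro W hW
    have dbl : ∀ {z}, z ∈ M ∩ N → r ∉ z ∧ z ∈ 𝒜 ∧ insert r z ∈ 𝒜 := by
      intro z hz
      obtain ⟨hzM, hzN⟩ := mem_inter.1 hz
      exact ⟨(mem_nonMemberSubfamily.1 hzN).2, (mem_nonMemberSubfamily.1 hzN).1, (mem_memberSubfamily.1 hzM).1⟩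
    simp only [mem_union, mem_image, mem_offDiag, Prod.exists] at hW
    rcases hW with ⟨x, y, ⟨hx, hy, hxy⟩, rfl⟩ | ⟨x, y, ⟨hx, hy, hxy⟩, rfl⟩
    · obtain ⟨hrx, hx𝒜, hx'⟩ := dbl hx
      obtain ⟨hry, hy𝒜, hy'⟩ := dbl hy
      have hxy' : insert r x ≠ insert r y := by
        intro h; apply hxy; rw [← erase_insert hrx, ← erase_insert hry, h]
      have hrW : r ∉ x ∩ y := fun h => hrx (mem_inter.1 h).1
      refine mem_inter.2 ⟨mem_memberSubfamily.2 ⟨?_, hrW⟩, mem_nonMemberSubfamily.2 ⟨inter_mem_rainbowMeets hx𝒜 hy𝒜 hxy, hrW⟩⟩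
      have e : insert r (x ∩ y) = insert r x ∩ insert r y := by ext t; simp only [mem_insert, mem_inter]; tauto
      rw [e]; exact inter_mem_rainbowMeets hx' hy' hxy'
    · obtain ⟨hrx, hx𝒜, hx'⟩ := dbl hx
      obtain ⟨hry, hy𝒜, hy'⟩ := dbl hy
      have hxy' : insert r x ≠ insert r y := by
        intro h; apply hxy; rw [← erase_insert hrx, ← erase_insert hry, h]
      have hrW : r ∉ (F.erase r) \ (x ∪ y) := fun h => (notMem_erase r F) (mem_sdiff.1 h).1
      refine mem_inter.2 ⟨mem_memberSubfamily.2 ⟨?_, hrW⟩, mem_nonMemberSubfamily.2 ⟨?_, hrW⟩⟩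
      · -- upper lift: `F \ (x ∪ y)` (contains `r`)
        have e : insert r ((F.erase r) \ (x ∪ y)) = F \ (x ∪ y) := by
          ext t
          simp only [mem_insert, mem_sdiff, mem_erase, mem_union]
          constructor
          · rintro (rfl | ⟨⟨hne, htF⟩, ht⟩)
            · exact ⟨hr, fun h => h.elim (fun h => hrx h) (fun h => hry h)⟩
            · exact ⟨htF, ht⟩
          · rintro ⟨htF, ht⟩
            by_cases htr : t = r
            · exact Or.inl htr
            · exact Or.inr ⟨⟨htr, htF⟩, ht⟩
        rw [e]; exact sdiff_union_mem_rainbowMeets hx𝒜 hy𝒜 hxy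
      · -- lower lift: `F \ (insert r x ∪ insert r y)`
        have e : (F.erase r) \ (x ∪ y) = F \ (insert r x ∪ insert r y) := by
          ext t; simp only [mem_sdiff, mem_erase, mem_union, mem_insert]; tauto
        rw [e]; exact sdiff_union_mem_rainbowMeets hx' hy' hxy'
  have hsplit := card_memberSubfamily_add_card_nonMemberSubfamily r L
  have hui := card_union_add_card_inter (L.memberSubfamily r) (L.nonMemberSubfamily r)
  have c1 := card_le_card h1
  have c2 := card_le_card h2
  omega

/-- **CREDIT LEMMA with the bonus term.**  If moreover `{r}` is a rainbow meet of `𝒜` and `∅` is NOT a meet / complemented join of two distinct doubled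
members, the count of `card_rainbowMeets_compress` improves by one (both lifts `∅`, `{r}` of `W = ∅` are present while the doubled pairs do not account for them).
Consequently compression at a GOOD point (`𝔅` complement-free and: no doubled member, or a disjoint/covering doubled pair, or `{r}` a rainbow meet) carries the
induction for `RainbowMeetCojoin`; a minimal counterexample has no good point (memo §7). [this work] -/
theorem card_rainbowMeets_compress_bonus (F : Finset α) (𝒜 : Finset (Finset α)) (r : α) (hr : r ∈ F)
    (hsing : ({r} : Finset α) ∈ rainbowMeets F 𝒜)
    (hno : (∅ : Finset α) ∉ ((𝒜.memberSubfamily r ∩ 𝒜.nonMemberSubfamily r).offDiag.image fun p => p.1 ∩ p.2) ∪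
        ((𝒜.memberSubfamily r ∩ 𝒜.nonMemberSubfamily r).offDiag.image fun p => (F.erase r) \ (p.1 ∪ p.2))) :
    #(rainbowMeets (F.erase r) (𝒜.memberSubfamily r ∪ 𝒜.nonMemberSubfamily r)) +
      #(((𝒜.memberSubfamily r ∩ 𝒜.nonMemberSubfamily r).offDiag.image fun p => p.1 ∩ p.2) ∪
        ((𝒜.memberSubfamily r ∩ 𝒜.nonMemberSubfamily r).offDiag.image fun p => (F.erase r) \ (p.1 ∪ p.2))) + 1
      ≤ #(rainbowMeets F 𝒜) := by
  set M := 𝒜.memberSubfamily r with hM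
  set N := 𝒜.nonMemberSubfamily r with hN
  set L := rainbowMeets F 𝒜 with hL
  -- lifting members of the projected family
  have lift : ∀ {z}, z ∈ M ∪ N → r ∉ z ∧ ∃ a ∈ 𝒜, a.erase r = z := by
    intro z hz
    rcases mem_union.1 hz with hz | hz
    · obtain ⟨hz1, hz2⟩ := mem_memberSubfamily.1 hz
      exact ⟨hz2, insert r z, hz1, erase_insert hz2⟩
    · obtain ⟨hz1, hz2⟩ := mem_nonMemberSubfamily.1 hz
      exact ⟨hz2, z, hz1, erase_eq_of_notMem hz2⟩
  -- (1) every rainbow meet of the projections has a lift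
  have h1 : rainbowMeets (F.erase r) (M ∪ N) ⊆ L.memberSubfamily r ∪ L.nonMemberSubfamily r := by
    intro W hW
    rcases mem_rainbowMeets_iff.1 hW with rfl | ⟨x, hx, y, hy, hxy, hW⟩
    · exact mem_union.2 (Or.inr (mem_nonMemberSubfamily.2 ⟨mem_rainbowMeets_iff.2 (Or.inl rfl), notMem_empty r⟩))
    obtain ⟨hrx, a, ha, hax⟩ := lift hx
    obtain ⟨hry, b, hb, hby⟩ := lift hy
    have hab : a ≠ b := by rintro rfl; exact hxy (hax.symm.trans hby)
    have key : ∃ Z ∈ L, Z.erase r = W ∧ r ∉ W := by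
      rcases hW with rfl | rfl
      · refine ⟨a ∩ b, inter_mem_rainbowMeets ha hb hab, ?_, fun h => hrx (mem_inter.1 h).1⟩
        rw [← hax, ← hby]; ext t; simp only [mem_erase, mem_inter]; tauto
      · refine ⟨F \ (a ∪ b), sdiff_union_mem_rainbowMeets ha hb hab, ?_, fun h => (notMem_erase r F) (mem_sdiff.1 h).1⟩
        rw [← hax, ← hby]; ext t; simp only [mem_erase, mem_sdiff, mem_union]; tauto
    obtain ⟨Z, hZ, hZW, hrW⟩ := key
    by_cases hrZ : r ∈ Z
    · refine mem_union.2 (Or.inl (mem_memberSubfamily.2 ⟨?_, hrW⟩))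
      rwa [← hZW, insert_erase hrZ]
    · refine mem_union.2 (Or.inr (mem_nonMemberSubfamily.2 ⟨?_, hrW⟩))
      rwa [← hZW, erase_eq_of_notMem hrZ]
  -- (2) meets / complemented joins of two distinct doubled members have both lifts
  have h2 : ((M ∩ N).offDiag.image fun p => p.1 ∩ p.2) ∪ ((M ∩ N).offDiag.image fun p => (F.erase r) \ (p.1 ∪ p.2)) ⊆
      L.memberSubfamily r ∩ L.nonMemberSubfamily r := by
    intro W hW
    have dbl : ∀ {z}, z ∈ M ∩ N → r ∉ z ∧ z ∈ 𝒜 ∧ insert r z ∈ 𝒜 := by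
      intro z hz
      obtain ⟨hzM, hzN⟩ := mem_inter.1 hz
      exact ⟨(mem_nonMemberSubfamily.1 hzN).2, (mem_nonMemberSubfamily.1 hzN).1, (mem_memberSubfamily.1 hzM).1⟩
    simp only [mem_union, mem_image, mem_offDiag, Prod.exists] at hW
    rcases hW with ⟨x, y, ⟨hx, hy, hxy⟩, rfl⟩ | ⟨x, y, ⟨hx, hy, hxy⟩, rfl⟩
    · obtain ⟨hrx, hx𝒜, hx'⟩ := dbl hx
      obtain ⟨hry, hy𝒜, hy'⟩ := dbl hy
      have hxy' : insert r x ≠ insert r y := by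
        intro h; apply hxy; rw [← erase_insert hrx, ← erase_insert hry, h]
      have hrW : r ∉ x ∩ y := fun h => hrx (mem_inter.1 h).1
      refine mem_inter.2 ⟨mem_memberSubfamily.2 ⟨?_, hrW⟩, mem_nonMemberSubfamily.2 ⟨inter_mem_rainbowMeets hx𝒜 hy𝒜 hxy, hrW⟩⟩
      have e : insert r (x ∩ y) = insert r x ∩ insert r y := by ext t; simp only [mem_insert, mem_inter]; tauto
      rw [e]; exact inter_mem_rainbowMeets hx' hy' hxy'
    · obtain ⟨hrx, hx𝒜, hx'⟩ := dbl hx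
      obtain ⟨hry, hy𝒜, hy'⟩ := dbl hy
      have hxy' : insert r x ≠ insert r y := by
        intro h; apply hxy; rw [← erase_insert hrx, ← erase_insert hry, h]
      have hrW : r ∉ (F.erase r) \ (x ∪ y) := fun h => (notMem_erase r F) (mem_sdiff.1 h).1
      refine mem_inter.2 ⟨mem_memberSubfamily.2 ⟨?_, hrW⟩, mem_nonMemberSubfamily.2 ⟨?_, hrW⟩⟩
      · -- upper lift: `F \ (x ∪ y)` (contains `r`)
        have e : insert r ((F.erase r) \ (x ∪ y)) = F \ (x ∪ y) := by
          ext t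
          simp only [mem_insert, mem_sdiff, mem_erase, mem_union]
          constructor
          · rintro (rfl | ⟨⟨hne, htF⟩, ht⟩)
            · exact ⟨hr, fun h => h.elim (fun h => hrx h) (fun h => hry h)⟩
            · exact ⟨htF, ht⟩
          · rintro ⟨htF, ht⟩
            by_cases htr : t = r
            · exact Or.inl htr
            · exact Or.inr ⟨⟨htr, htF⟩, ht⟩
        rw [e]; exact sdiff_union_mem_rainbowMeets hx𝒜 hy𝒜 hxy
      · -- lower lift: `F \ (insert r x ∪ insert r y)`
        have e : (F.erase r) \ (x ∪ y) = F \ (insert r x ∪ insert r y) := by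
          ext t; simp only [mem_sdiff, mem_erase, mem_union, mem_insert]; tauto
        rw [e]; exact sdiff_union_mem_rainbowMeets hx' hy' hxy'
  -- the bonus: `∅` has both lifts (`∅` and `{r}`) but is not among the doubled pairs' products
  have h3 : insert (∅ : Finset α) (((M ∩ N).offDiag.image fun p => p.1 ∩ p.2) ∪ ((M ∩ N).offDiag.image fun p => (F.erase r) \ (p.1 ∪ p.2))) ⊆
      L.memberSubfamily r ∩ L.nonMemberSubfamily r := by
    intro W hW
    rcases mem_insert.1 hW with rfl | hW
    · refine mem_inter.2 ⟨mem_memberSubfamily.2 ⟨?_, notMem_empty r⟩, mem_nonMemberSubfamily.2 ⟨mem_rainbowMeets_iff.2 (Or.inl rfl), notMem_empty r⟩⟩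
      have e : insert r (∅ : Finset α) = {r} := by ext t; simp
      rw [e]; exact hsing
    · exact h2 hW
  have hsplit := card_memberSubfamily_add_card_nonMemberSubfamily r L
  have hui := card_union_add_card_inter (L.memberSubfamily r) (L.nonMemberSubfamily r)
  have c1 := card_le_card h1
  have c3 := card_le_card h3
  rw [card_insert_of_notMem hno] at c3
  omega

/-- **The GOOD-point step for the rainbow lemma.**  Let `𝒜 ⊆ 2^F` be complement-free, `r ∈ F`, and suppose the projected family
`𝔅 = 𝒜.memberSubfamily r ∪ 𝒜.nonMemberSubfamily r` is complement-free in `F.erase r` and `r` is GOOD: there is no doubled member, or two distinct doubled members are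
disjoint or cover `F.erase r`, or `{r}` is a rainbow meet of `𝒜`.  If the rainbow lemma holds for all complement-free families inside `F.erase r`, it holds for `𝒜`.
Hence a minimal counterexample to `RainbowMeetCojoin` has no good point (memo §7). [this work] -/
theorem card_le_card_rainbowMeets_of_good (F : Finset α) (𝒜 : Finset (Finset α)) (r : α) (hr : r ∈ F)
    (h𝒜F : ∀ a ∈ 𝒜, a ⊆ F) (hcf : ∀ a ∈ 𝒜, F \ a ∉ 𝒜)
    (h𝔅 : ∀ b ∈ 𝒜.memberSubfamily r ∪ 𝒜.nonMemberSubfamily r, (F.erase r) \ b ∉ 𝒜.memberSubfamily r ∪ 𝒜.nonMemberSubfamily r)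
    (hgood : 𝒜.memberSubfamily r ∩ 𝒜.nonMemberSubfamily r = ∅ ∨
      (∅ : Finset α) ∈ (((𝒜.memberSubfamily r ∩ 𝒜.nonMemberSubfamily r).offDiag.image fun p => p.1 ∩ p.2) ∪
        ((𝒜.memberSubfamily r ∩ 𝒜.nonMemberSubfamily r).offDiag.image fun p => (F.erase r) \ (p.1 ∪ p.2))) ∨
      ({r} : Finset α) ∈ rainbowMeets F 𝒜)
    (IH : ∀ 𝒞 : Finset (Finset α), (∀ c ∈ 𝒞, c ⊆ F.erase r) → (∀ c ∈ 𝒞, (F.erase r) \ c ∉ 𝒞) → #𝒞 ≤ #(rainbowMeets (F.erase r) 𝒞)) :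
    #𝒜 ≤ #(rainbowMeets F 𝒜) := by
  set M := 𝒜.memberSubfamily r with hM
  set N := 𝒜.nonMemberSubfamily r with hN
  set P := ((M ∩ N).offDiag.image fun p => p.1 ∩ p.2) ∪ ((M ∩ N).offDiag.image fun p => (F.erase r) \ (p.1 ∪ p.2)) with hP
  have hsum : #(M ∪ N) + #(M ∩ N) = #𝒜 := by
    rw [card_union_add_card_inter]; exact card_memberSubfamily_add_card_nonMemberSubfamily r 𝒜
  -- members of the compressed families lie in `F.erase r`
  have hsubMN : ∀ b ∈ M ∪ N, b ⊆ F.erase r := by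
    intro b hb
    rcases mem_union.1 hb with hb | hb
    · obtain ⟨hb1, hb2⟩ := mem_memberSubfamily.1 hb
      intro t ht
      exact mem_erase.2 ⟨fun h => hb2 (h ▸ ht), h𝒜F _ hb1 (mem_insert_of_mem ht)⟩
    · obtain ⟨hb1, hb2⟩ := mem_nonMemberSubfamily.1 hb
      intro t ht
      exact mem_erase.2 ⟨fun h => hb2 (h ▸ ht), h𝒜F _ hb1 ht⟩
  have hsubA : ∀ b ∈ M ∩ N, b ⊆ F.erase r := fun b hb => hsubMN b (mem_union.2 (Or.inl (mem_inter.1 hb).1))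
  -- the doubled family is complement-free (a complementary pair there would give one in `𝒜`)
  have hcfA : ∀ b ∈ M ∩ N, (F.erase r) \ b ∉ M ∩ N := by
    intro b hb hb'
    obtain ⟨_, hbN⟩ := mem_inter.1 hb
    obtain ⟨hb'M, _⟩ := mem_inter.1 hb'
    have hb𝒜 : b ∈ 𝒜 := (mem_nonMemberSubfamily.1 hbN).1
    have h1 : insert r ((F.erase r) \ b) ∈ 𝒜 := (mem_memberSubfamily.1 hb'M).1
    have hrb : r ∉ b := (mem_nonMemberSubfamily.1 hbN).2
    have e : insert r ((F.erase r) \ b) = F \ b := by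
      ext t
      simp only [mem_insert, mem_sdiff, mem_erase]
      constructor
      · rintro (rfl | ⟨⟨_, htF⟩, htb⟩)
        · exact ⟨hr, hrb⟩
        · exact ⟨htF, htb⟩
      · rintro ⟨htF, htb⟩
        by_cases htr : t = r
        · exact Or.inl htr
        · exact Or.inr ⟨⟨htr, htF⟩, htb⟩
    rw [e] at h1
    exact hcf b hb𝒜 h1
  -- rainbow meets of the doubled family vs. its proper part `P`
  have hMA : rainbowMeets (F.erase r) (M ∩ N) = insert ∅ P := rfl
  have IHB := IH (M ∪ N) hsubMN h𝔅
  have IHA := IH (M ∩ N) hsubA hcfA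
  rw [hMA] at IHA
  have hPle : #(insert (∅ : Finset α) P) ≤ #P + 1 := card_insert_le _ _
  have c1 := card_rainbowMeets_compress F 𝒜 r hr
  rw [← hM, ← hN] at c1
  rw [← hP] at c1
  rcases hgood with h0 | h0 | h0
  · -- no doubled member
    have : #(M ∩ N) = 0 := by rw [h0]; rfl
    omega
  · -- `∅` is a product of two distinct doubled members: no loss
    have : insert (∅ : Finset α) P = P := insert_eq_of_mem h0
    rw [this] at IHA
    omega
  · -- `{r}` is a rainbow meet: the bonus repays the possible loss
    by_cases h00 : (∅ : Finset α) ∈ P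
    · have : insert (∅ : Finset α) P = P := insert_eq_of_mem h00
      rw [this] at IHA
      omega
    · have c2 := card_rainbowMeets_compress_bonus F 𝒜 r hr h0 h00
      rw [← hM, ← hN] at c2
      rw [← hP] at c2
      omega

end Summit.CriticalPhenomena.PercolationContinuityZ3.Theorems.SahiColouredDaykin
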